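import Summits.QuantumFields.YangMills.Theorems.BalabanUVNodesN15KingModelTorusMassGap
import Summits.QuantumFields.YangMills.Theorems.BalabanUVNodesN15KingModelBlockCovarianceIdentity
import HarnessLib

/-!
# BalabanUVNodes ∕ N15 — THE KING-MODEL RUNG (PART Ϲ-d): THE ZERO-MOMENTUM TIMESLICE CORRELATOR OF KING's RG BLOCK-FIELD COVARIANCE
# `(Δ^{(K)})⁻¹` IS THE BLOCK-SPIN NOISE AT COINCIDENCE PLUS THE DOUBLE BLOCK AVERAGE OF THE FINE FIELD's CYCLE RESOLVENT
# (Track A, DAG node N15 = NE2; FAN-OUT v1.1 §N15 s3 «KING-MODEL RUNG … NE2's analogue DECIDED in the model»; count-neutral)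

HONEST FRAMING.  Count-neutral (cell `pub-ymgap`, seat `pub-ymgap-dag-n15-e` g38; `--supports stmt-QuantumFields-27366 --as helper` = K3⁸).
TEMPLATE LITERATURE: C. King, Commun. Math. Phys. **102** (1986) 649–677 [King1986] — King's OWN `A = 0` objects: the unit-lattice EFFECTIVE
LAPLACIAN `Δ^{(k)} = a_k − a_k²Q_kG_kQ_k^*` ((2.14) p.653, (4.5) p.670; the tree's `effLaplacian N M a N² m²`, `N = L^k`) whose inverse is the
covariance of the RG block-field law `dμ^{(k)}` and NE2's unit-layer kernel in the model (this seat's g0 `blockCov`), written by PART Ϛ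
(`effLaplacian_inv_eq_noise_add_blockAvg`, (2.13)–(2.14) + (4.44)) as WHITE NOISE PLUS THE BLOCK-AVERAGED FREE PROPAGATOR
`(Δ^{(K)})⁻¹ = a⁻¹·1 + N^d·Q B⁻¹ Qᵀ`, `B = N²(−Δ) + m²` on the fine torus; the timeslice reading is Montvay–Münster [MontvayMunster1994] §2.1.2
(2.18)–(2.20), (2.49).  PART Ϲ-b gave the fine field's zero-momentum timeslice correlator between any two slices as the cycle resolvent
(`timeSlice_lapF_inv_eq_cycleGreen_source`).  THIS FILE pushes it through King's block mean `Q`: the block field's zero-momentum correlator at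
block-time separation `s` is `a⁻¹·[s = 0]` plus `N^{−3}` times the fine resolvent summed over all `N²` pairs of fine times in the two time-blocks.
NOT Bałaban's covariant objects; NOT a node discharge (N15 is booked through n15-a's knit, untouched); nothing continuum-YM ∕ ℝ⁴ ∕ OS axioms ∕ Clay.
0 `sorry`, 0 `def`.

WHAT THIS FILE PROVES (kernel).  §1 block-slab bookkeeping on King's two-level torus (`site`, `blockOf`, `blockEquiv`, `Qmat` of `King1986.Torus`):
`sum_fine_eq_sum_blocks`, ★ `site_apply_eq_iff` (`(N·b + j)_κ = N·val s + i ↔ b_κ = s ∧ j_κ = i`), ★ `sum_blockSlab_eq_sum_slices` (a block time-slab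
is `N` consecutive fine timeslices), `sum_offsets_apply_kappa`, ★ `sum_block_zero_kappa` (`Σ_{y ∈ B(0)} f(y_κ) = N^{d−1}·Σ_{i<N} f(i)`).
§2 `Qmat_eq_boole`, `Qmat_mul_mul_transpose_apply` (`(QGQᵀ)(b,0)` in indicator form), ★★★ **`timeSlice_blockCov_eq_sum`**
(`Σ_{b : b_κ = s} (Δ^{(K)})⁻¹(b,0) = a⁻¹·[s = 0] + N^{−3}·Σ_{i,i′<N} cycleGreen (N·M_κ) (m²∕N²) (N·val s + i − i′)`).

HONEST SCOPE.  King's `A = 0` free model; unit torus `Tor M` with `N ≥ 1` fine sites per block side (`d ≥ 1` via the axis `κ`), `a > 0`, `m² > 0`;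
zero spatial momentum only (unit-lattice plane waves bring in the alias sums of (4.5) and are not treated).  The evaluation of the double block
sum as a pure `cosh` in block time (mass `N·ω₀`) is PART Ϲ-d′ (`…KingModelBlockFieldMassGap`).  N15 untouched; counts unmoved.
Locators: [King1986] (2.10) p.653, (2.13)–(2.14) p.653, (4.1)–(4.5) p.670, (4.44) p.675; [MontvayMunster1994] §2.1.2 (2.18)–(2.20), (2.49).
-/

noncomputable section

open scoped BigOperators
open Finset Matrix Real

namespace Summit.QuantumFields.YangMills.BalabanUVNodes.N15KingModelRung.TorusSpectral

open Literature.MathematicalPhysics.QuantumFieldTheory.Balaban1983to89.B5Prop11Plancherel (Tor fine)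
open Literature.MathematicalPhysics.QuantumFieldTheory.King1986
open Literature.MathematicalPhysics.QuantumFieldTheory.King1986.Torus

variable {d : ℕ} (N : ℕ) [NeZero N] (M : Fin d → ℕ) [hM : ∀ μ, NeZero (M μ)] (κ : Fin d)

/-! ## §1 Block-slab bookkeeping on the two-level torus -/

section Slabs

variable {α : Type*} [AddCommMonoid α]

/-- `Σ_{x ∈ Ω_η} F(x) = Σ_b Σ_{j ∈ [0,N)^d} F(N·b + j)` (the block parametrisation `blockEquiv`). [cite: King1986, (2.10) p.653, (4.1) p.670] -/
theorem sum_fine_eq_sum_blocks (F : Tor (fine N M) → α) :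
    ∑ x : Tor (fine N M), F x = ∑ b : Tor M, ∑ j : Fin d → Fin N, F (site N M b j) := by
  rw [← Fintype.sum_prod_type']
  exact (Fintype.sum_equiv (Torus.blockEquiv N M) _ _ fun bj => rfl).symm

/-- ★ `(N·b + j)_κ = N·val s + i` in `ℤ∕(N·M_κ)` iff `b_κ = s` and `j_κ = i` (Euclidean division; no wrap-around since `N·val b_κ + j_κ < N·M_κ`).
[folklore] -/
theorem site_apply_eq_iff (b : Tor M) (j : Fin d → Fin N) (s : ZMod (M κ)) (i : Fin N) :
    site N M b j κ = ((N * s.val + (i : ℕ) : ℕ) : ZMod (fine N M κ)) ↔ b κ = s ∧ j κ = i := by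
  have hN : 0 < N := Nat.pos_of_ne_zero (NeZero.ne N)
  have hlt : ∀ (t : ZMod (M κ)) (l : Fin N), N * t.val + (l : ℕ) < fine N M κ := by
    intro t l
    have ht : t.val < M κ := ZMod.val_lt _
    have hl : (l : ℕ) < N := l.isLt
    show N * t.val + (l : ℕ) < N * M κ
    calc N * t.val + (l : ℕ) < N * t.val + N := by omega
      _ = N * (t.val + 1) := by ring
      _ ≤ N * M κ := Nat.mul_le_mul_left _ ht
  constructor
  · intro h
    have hv := congrArg ZMod.val h
    rw [val_site, ZMod.val_natCast, Nat.mod_eq_of_lt (hlt s i)] at hv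
    have hdiv : (b κ).val = s.val := by
      have := congrArg (· / N) hv
      simpa [Nat.mul_add_div hN, Nat.div_eq_of_lt (j κ).isLt, Nat.div_eq_of_lt i.isLt] using this
    have hmod : (j κ : ℕ) = (i : ℕ) := by
      have := congrArg (· % N) hv
      simpa [Nat.mul_add_mod, Nat.mod_eq_of_lt (j κ).isLt, Nat.mod_eq_of_lt i.isLt] using this
    exact ⟨ZMod.val_injective _ hdiv, Fin.ext hmod⟩
  · rintro ⟨hb, hj⟩
    apply ZMod.val_injective
    rw [val_site, ZMod.val_natCast, Nat.mod_eq_of_lt (hlt s i), hb, hj]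

/-- ★ A BLOCK TIME-SLAB IS `N` CONSECUTIVE FINE TIMESLICES: `Σ_{x : ⌊x∕N⌋_κ = s} F(x) = Σ_{i<N} Σ_{x : x_κ = N·val s + i} F(x)`.
[cite: King1986, (2.10) p.653, (4.1) p.670] -/
theorem sum_blockSlab_eq_sum_slices (F : Tor (fine N M) → α) (s : ZMod (M κ)) :
    ∑ x : Tor (fine N M), (if blockOf N M x κ = s then F x else 0)
      = ∑ i : Fin N, ∑ x : Tor (fine N M), (if x κ = ((N * s.val + (i : ℕ) : ℕ) : ZMod (fine N M κ)) then F x else 0) := by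
  rw [sum_fine_eq_sum_blocks N M (fun x => if blockOf N M x κ = s then F x else 0),
    Finset.sum_congr rfl fun (i : Fin N) _ =>
      sum_fine_eq_sum_blocks N M (fun x => if x κ = ((N * s.val + (i : ℕ) : ℕ) : ZMod (fine N M κ)) then F x else 0)]
  simp only [blockOf_site, site_apply_eq_iff]
  conv_rhs => rw [Finset.sum_comm]
  refine Finset.sum_congr rfl fun b _ => ?_
  rw [Finset.sum_comm]
  refine Finset.sum_congr rfl fun j _ => ?_
  by_cases hb : b κ = s
  · simp only [hb, true_and, if_true]
    rw [Finset.sum_ite_eq Finset.univ (j κ)]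
    simp
  · simp [hb]

omit [NeZero N] hM in
/-- ★ `Σ_{j ∈ [0,N)^d} f(j_κ) = N^{d−1}·Σ_{i<N} f(i)` (the other `d − 1` offsets are free). [folklore] -/
theorem sum_offsets_apply_kappa (f : Fin N → α) :
    ∑ j : Fin d → Fin N, f (j κ) = (N ^ (d - 1)) • ∑ i : Fin N, f i := by
  rw [Fintype.sum_equiv (Equiv.piSplitAt κ (fun _ : Fin d => Fin N)) (fun j => f (j κ)) (fun q => f q.1) (fun j => rfl),
    Fintype.sum_prod_type, Finset.smul_sum]
  refine Finset.sum_congr rfl fun i _ => ?_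
  dsimp only
  rw [Finset.sum_const, Finset.card_univ, Fintype.card_fun, Fintype.card_fin, Fintype.card_subtype_compl, Fintype.card_subtype_eq,
    Fintype.card_fin]

/-- `Σ_{y ∈ B(0)} f(y_κ) = N^{d−1}·Σ_{i<N} f(i)` — the sites of the block at the origin, read on their time coordinate. [cite: King1986, (4.1) p.670] -/
theorem sum_block_zero_kappa (f : ZMod (fine N M κ) → α) :
    ∑ y : Tor (fine N M), (if blockOf N M y = 0 then f (y κ) else 0) = (N ^ (d - 1)) • ∑ i : Fin N, f ((i : ℕ) : ZMod (fine N M κ)) := by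
  rw [sum_fine_eq_sum_blocks]
  simp_rw [blockOf_site]
  rw [Finset.sum_eq_single (0 : Tor M)]
  · simp only [if_true]
    have : ∀ j : Fin d → Fin N, site N M 0 j κ = ((j κ : ℕ) : ZMod (fine N M κ)) := by
      intro j; simp [site]
    simp_rw [this]
    exact sum_offsets_apply_kappa N κ (fun i : Fin N => f ((i : ℕ) : ZMod (fine N M κ)))
  · intro b _ hb; simp [hb]
  · intro h; exact absurd (Finset.mem_univ _) h

end Slabs

/-! ## §2 The block field's zero-momentum timeslice correlator as a double block average of the fine one -/

section BlockField

variable {a m2 : ℝ}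

/-- `Q(b,x) = N^{−d}·[x ∈ B(b)]` as a product with an indicator. [cite: King1986, (2.10) p.653, (4.1) p.670] -/
theorem Qmat_eq_boole (b : Tor M) (x : Tor (fine N M)) :
    Qmat N M b x = ((N : ℝ) ^ d)⁻¹ * (if blockOf N M x = b then 1 else 0) := by
  unfold Qmat
  split_ifs <;> simp

/-- The block average of a kernel against the origin block, in indicator form:
`(Q G Qᵀ)(b,0) = N^{−2d} Σ_x Σ_y [x ∈ B(b)]·([y ∈ B(0)]·G(x,y))`. [cite: King1986, (2.10) p.653, (2.14) p.653] -/
theorem Qmat_mul_mul_transpose_apply (G : Matrix (Tor (fine N M)) (Tor (fine N M)) ℝ) (b : Tor M) :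
    (Qmat N M * G * (Qmat N M)ᵀ) b 0
      = ((N : ℝ) ^ d)⁻¹ * ((N : ℝ) ^ d)⁻¹ * ∑ x : Tor (fine N M), ∑ y : Tor (fine N M),
          (if blockOf N M x = b then (1 : ℝ) else 0) * ((if blockOf N M y = 0 then (1 : ℝ) else 0) * G x y) := by
  simp only [Matrix.mul_apply, Matrix.transpose_apply, Qmat_eq_boole]
  rw [Finset.sum_comm, Finset.mul_sum]
  refine Finset.sum_congr rfl fun x _ => ?_
  rw [Finset.mul_sum, Finset.sum_mul]
  refine Finset.sum_congr rfl fun y _ => ?_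
  ring

/-- ★★★ **THE RG BLOCK FIELD's ZERO-MOMENTUM TIMESLICE CORRELATOR IS NOISE AT COINCIDENCE PLUS THE DOUBLE BLOCK AVERAGE OF THE FINE ONE**:
for King's block covariance `(Δ^{(K)})⁻¹ = a⁻¹·1 + N^d·QB⁻¹Qᵀ` (PART Ϛ), `B = N²(−Δ)+m²`, every block-time `s`:
`Σ_{b : b_κ = s} (Δ^{(K)})⁻¹(b,0) = a⁻¹·[s = 0] + N^{−3}·Σ_{i,i′<N} g(N·val s + i − i′)`, `g = cycleGreen (N·M_κ) (m²∕N²)` — the fine field's cycle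
resolvent (PART Ϲ-b) read at all pairs of fine times in the two blocks. [cite: King1986, (2.13)–(2.14) p.653, (4.44) p.675; MontvayMunster1994, §2.1.2 (2.18)–(2.20)] -/
theorem timeSlice_blockCov_eq_sum (hN1 : 1 ≤ N) (ha : 0 < a) (hm : 0 < m2) (s : ZMod (M κ)) :
    ∑ b : Tor M, (if b κ = s then (effLaplacian N M a ((N : ℝ) ^ 2) m2)⁻¹ b 0 else 0)
      = a⁻¹ * (if s = 0 then 1 else 0)
        + (((N : ℝ) ^ 3)⁻¹) * ∑ i : Fin N, ∑ i' : Fin N,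
            cycleGreen (fine N M κ) (m2 / (N : ℝ) ^ 2)
              ((((N * s.val + (i : ℕ) : ℕ)) : ZMod (fine N M κ)) - ((i' : ℕ) : ZMod (fine N M κ))) := by
  set S : ℝ := ∑ i : Fin N, ∑ i' : Fin N, cycleGreen (fine N M κ) (m2 / (N : ℝ) ^ 2)
      ((((N * s.val + (i : ℕ) : ℕ)) : ZMod (fine N M κ)) - ((i' : ℕ) : ZMod (fine N M κ))) with hS
  have hNr : (0 : ℝ) < N := by exact_mod_cast Nat.pos_of_ne_zero (NeZero.ne N)
  have hN2 : (0 : ℝ) < (N : ℝ) ^ 2 := by positivity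
  have hd : 1 ≤ d := Fin.pos κ
  set G : Matrix (Tor (fine N M)) (Tor (fine N M)) ℝ := (lapF (fine N M) ((N : ℝ) ^ 2) m2)⁻¹ with hGdef
  rw [effLaplacian_inv_eq_noise_add_blockAvg N M hN1 ha hm, ← hGdef]
  simp only [Matrix.add_apply, Matrix.smul_apply, Matrix.one_apply, smul_eq_mul]
  -- split the slice sum into the noise and the block part
  have hsplit : ∀ b : Tor M, (if b κ = s then a⁻¹ * (if b = 0 then (1 : ℝ) else 0) + (N : ℝ) ^ d * (Qmat N M * G * (Qmat N M)ᵀ) b 0 else 0)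
      = a⁻¹ * ((if b κ = s then (1 : ℝ) else 0) * (if b = 0 then 1 else 0))
        + (N : ℝ) ^ d * ((if b κ = s then (1 : ℝ) else 0) * (Qmat N M * G * (Qmat N M)ᵀ) b 0) := by
    intro b; split_ifs <;> ring
  simp_rw [hsplit]
  rw [Finset.sum_add_distrib, ← Finset.mul_sum, ← Finset.mul_sum]
  -- the noise term: `Σ_b [b_κ = s][b = 0] = [s = 0]`
  have hnoise : ∑ b : Tor M, (if b κ = s then (1 : ℝ) else 0) * (if b = 0 then 1 else 0) = if s = 0 then 1 else 0 := by
    rw [Finset.sum_eq_single (0 : Tor M)]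
    · simp only [Pi.zero_apply, if_true, mul_one]
      by_cases hs : s = 0
      · rw [if_pos hs, if_pos hs.symm]
      · rw [if_neg hs, if_neg (Ne.symm hs)]
    · intro b _ hb; rw [if_neg hb, mul_zero]
    · intro h; exact absurd (Finset.mem_univ _) h
  -- the block part, pointwise in `b`
  have hpt : ∀ b : Tor M, (if b κ = s then (1 : ℝ) else 0) * (Qmat N M * G * (Qmat N M)ᵀ) b 0
      = ((N : ℝ) ^ d)⁻¹ * ((N : ℝ) ^ d)⁻¹ * ∑ x : Tor (fine N M), ∑ y : Tor (fine N M),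
          ((if b κ = s then (1 : ℝ) else 0) * (if blockOf N M x = b then (1 : ℝ) else 0))
            * ((if blockOf N M y = 0 then (1 : ℝ) else 0) * G x y) := by
    intro b
    rw [Qmat_mul_mul_transpose_apply, mul_left_comm]
    congr 1
    rw [Finset.mul_sum]
    refine Finset.sum_congr rfl fun x _ => ?_
    rw [Finset.mul_sum]
    refine Finset.sum_congr rfl fun y _ => ?_
    ring
  -- collapse the `b`-sum onto `blockOf x`: `Σ_b [b_κ = s][x ∈ B(b)] = [⌊x∕N⌋_κ = s]`
  have hcollapse : ∀ x : Tor (fine N M), ∑ b : Tor M, (if b κ = s then (1 : ℝ) else 0) * (if blockOf N M x = b then (1 : ℝ) else 0)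
      = if blockOf N M x κ = s then (1 : ℝ) else 0 := by
    intro x
    rw [Finset.sum_mul_boole]
    simp
  have hblock : ∑ b : Tor M, (if b κ = s then (1 : ℝ) else 0) * (Qmat N M * G * (Qmat N M)ᵀ) b 0
      = ((N : ℝ) ^ d)⁻¹ * ((N : ℝ) ^ d)⁻¹ * ∑ y : Tor (fine N M), (if blockOf N M y = 0 then (1 : ℝ) else 0)
          * ∑ x : Tor (fine N M), (if blockOf N M x κ = s then G x y else 0) := by
    rw [Finset.sum_congr rfl fun b _ => hpt b, ← Finset.mul_sum]
    congr 1
    rw [Finset.sum_comm]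
    have hx : ∀ x : Tor (fine N M), ∑ b : Tor M, ∑ y : Tor (fine N M),
        ((if b κ = s then (1 : ℝ) else 0) * (if blockOf N M x = b then (1 : ℝ) else 0)) * ((if blockOf N M y = 0 then (1 : ℝ) else 0) * G x y)
        = (if blockOf N M x κ = s then (1 : ℝ) else 0) * ∑ y : Tor (fine N M), (if blockOf N M y = 0 then (1 : ℝ) else 0) * G x y := by
      intro x; rw [← Finset.sum_mul_sum, hcollapse x]
    simp_rw [hx, Finset.mul_sum]
    rw [Finset.sum_comm]
    refine Finset.sum_congr rfl fun y _ => Finset.sum_congr rfl fun x _ => ?_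
    split_ifs <;> simp
  -- the fine slab: `N` consecutive timeslices, each a cycle resolvent (PART Ϲ-b)
  have hslab : ∀ y : Tor (fine N M), ∑ x : Tor (fine N M), (if blockOf N M x κ = s then G x y else 0)
      = ∑ i : Fin N, ((N : ℝ) ^ 2)⁻¹ * cycleGreen (fine N M κ) (m2 / (N : ℝ) ^ 2)
          ((((N * s.val + (i : ℕ) : ℕ)) : ZMod (fine N M κ)) - y κ) := by
    intro y
    rw [sum_blockSlab_eq_sum_slices]
    refine Finset.sum_congr rfl fun i _ => ?_
    rw [hGdef, timeSlice_lapF_inv_eq_cycleGreen_source (fine N M) κ hN2 hm]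
  simp_rw [hnoise, hblock, hslab]
  -- `Σ_y [y ∈ B(0)]·f(y_κ) = N^{d−1}·Σ_{i′} f(i′)`
  have hB0 := sum_block_zero_kappa N M κ (fun w => ∑ i : Fin N, ((N : ℝ) ^ 2)⁻¹ * cycleGreen (fine N M κ) (m2 / (N : ℝ) ^ 2)
      ((((N * s.val + (i : ℕ) : ℕ)) : ZMod (fine N M κ)) - w))
  have hite : ∀ y : Tor (fine N M), (if blockOf N M y = 0 then (1 : ℝ) else 0)
      * (∑ i : Fin N, ((N : ℝ) ^ 2)⁻¹ * cycleGreen (fine N M κ) (m2 / (N : ℝ) ^ 2) ((((N * s.val + (i : ℕ) : ℕ)) : ZMod (fine N M κ)) - y κ))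
      = if blockOf N M y = 0 then (∑ i : Fin N, ((N : ℝ) ^ 2)⁻¹ * cycleGreen (fine N M κ) (m2 / (N : ℝ) ^ 2)
          ((((N * s.val + (i : ℕ) : ℕ)) : ZMod (fine N M κ)) - y κ)) else 0 := by
    intro y; split_ifs <;> simp
  simp_rw [hite]
  rw [hB0, nsmul_eq_mul]
  simp_rw [← Finset.mul_sum]
  have hfold : ∑ i' : Fin N, ∑ i : Fin N, cycleGreen (fine N M κ) (m2 / (N : ℝ) ^ 2)
      ((((N * s.val + (i : ℕ) : ℕ)) : ZMod (fine N M κ)) - ((i' : ℕ) : ZMod (fine N M κ))) = S := by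
    rw [hS, Finset.sum_comm]
  rw [hfold]
  -- constants: `N^d · N^{−d} · N^{−d} · N^{d−1} · N^{−2} = N^{−3}`
  have hconst : (N : ℝ) ^ d * (((N : ℝ) ^ d)⁻¹ * ((N : ℝ) ^ d)⁻¹) * (((N ^ (d - 1) : ℕ)) : ℝ) * ((N : ℝ) ^ 2)⁻¹ = ((N : ℝ) ^ 3)⁻¹ := by
    have hdd : (N : ℝ) ^ d = (N : ℝ) ^ (d - 1) * N := by
      rw [← pow_succ]; congr 1; omega
    push_cast
    rw [hdd]
    field_simp
  congr 1
  rw [← hconst]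
  ring

end BlockField

end Summit.QuantumFields.YangMills.BalabanUVNodes.N15KingModelRung.TorusSpectral
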